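import Literature.MathematicalPhysics.QuantumFieldTheory.Balaban1983to89.Node00.OpsYSectDE

/-!
# `Balaban1983to89.B9CubeLettersInvReadings` — T. Bałaban, *Propagators for lattice gauge theories in a background field*, Commun. Math. Phys.
# **99** (1985) 389–434 [Balaban1985BackgroundPropagators], (3.39)–(3.47) pp. 397–398 read over the GAUGE-INVARIANT TEST CLASS, and the
# mechanism of p. 398 «All these inequalities are invariant with respect to gauge transformations of U» for these readings (equal constants)

statement-level skeleton of published theorems with citation tags; proofs where landed; nothing here is a claim about the Yang–Mills mass gap

PDF held: `paper:balaban1985-cmp99-background-propagators` (journal page = PDF page + 388); pp. 395–398 read from the held text layer.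

THE PRINT.  p. 397 (3.39)–(3.41): the norms `|λ| = sup_x |λ(x)|`, `‖λ‖_α`, `|λ|_{(α)}` of 𝔤- (or M_N-) valued lattice functions `λ` — sups over
ALL such `λ`; p. 398 after (3.47): *«All these inequalities are invariant with respect to gauge transformations of U»*; pp. 395–396 (3.28)–(3.34):
`X(U^u) = R(u)X(U)R(u⁻¹)` for `X = ∇_U, ∇*_U, Δ_U, G′, G`, `(R(u)λ)(x) = R(u(x))λ(x) = u(x)λ(x)u(x)⁻¹`, and `|R(u(x))Y| = |Y|` for `u(x) ∈ G ⊂ U(N)`;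
p. 408 (Cor. 3.6): *«all the results of these theorems are gauge invariant, so they hold for the configuration U also.»*

WHY THIS FILE (cell context: G-B9-LETTERS, module M5.2 of r06's `B9-LETTERS-MAP.md` v1).  def-Y's readings `Node00.kernelFamilyS ∕ kernelFamilyB`
(`Node00/OpsYOfLetters`) take the outer sup over PRODUCT test functions `λ ⊗ E` (`liftY f E`, `E ∈ BallY 𝔸`).  That class is NOT stable under
`λ ↦ R(u)⁻¹λ` (`R(u(x))⁻¹(f(x)E)` is not a product), so for product readings the p. 398 sentence holds only up to a basis constant, while the cell's
typed gauge reduction `B9.GaugeReduction335` ∕ `B9GaugeReduction335Whole.thms31to33IneqAt_of_invariant` transfers the block `B9.Thms31to33IneqAt` with the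
SAME constants along EXACT reading invariance (`KernelReadingsInvariant`).  Print's norms are sups over all `λ`; this file therefore defines the
readings of a site-sector ∕ bond-sector letter over the INVARIANT CLASS `TestY 𝔸 f = {Λ ∕∕ ‖Λ(z)‖ ≤ |f(z)| ∀ z}` (⊇ the products, `testYOfBall`) —
`kernelFamilySInv`, `kernelFamilyBInv`, verbatim mirrors of def-Y's functors with `⨆ E : BallY 𝔸, …(liftY f E)` replaced by `⨆ Λ : TestY 𝔸 f, …Λ` —
and PROVES the pointwise invariance of every constituent quantity under `R(u)` for a gauge function that is a BI-CONTRACTION at every point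
(`IsBiContr`: `‖u(x)‖ ≤ 1 ∧ ‖u(x)⁻¹‖ ≤ 1`, the typed form of «u(x) ∈ G ⊂ U(N)», giving `‖R(u(x))a‖ = ‖a‖`) together with the calculus laws (3.31)′
as function identities on both sectors.  Consumers: `B9CubeLettersGaugeTransport` (the block transfer with equal constants for covariant letters) and
`B9Cor36GaugeReductionCube` (Cor. 3.6 on one cube).  Nothing of def-Y's is restated: carriers, letters, calculus and constituent readings are def-Y's
own (`Node00.OpsYOfLetters`, `Node00.OpsYGauge`); only the outer sup changes.

WHAT IS PROVED (all `theorem`s, no `sorry`).  §1 `IsBiContr` (+ `inv`, `norm_R`, `one`), `TestY` (+ `testY_nonempty`, `testYOfBall`, the `R(u)`-action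
`testYConj` as an `Equiv`, `ballConj`, `deltaY_conj`); §2 the invariances `supBlkS_congrR`, `supBlkS'_congrR`, `supInB_congrR`, `l2OfY_congrR`,
`wNormSY_congrR`, `wNormBY_congrR`, the Hölder ones `hqS_congrR`, `holderQB_congrR` (transporter law + bi-contraction ⇒ equal quotients), their rewriting forms `…_conjY`
(`IsBiContr.site ∕ bond ∕ blk`, `hqS_smul_conjY`, `holderQB_conjY`, `wNormSY_smul_conjY`), and the calculus laws `cdS_conj`, `cdsS_conj`, `lapS_conj`, `gaugeY_eq_gaugeTr`, `cdB_conj`, `cdsB_conj`, `lapB_conj`; §3 the definitions `kernelFamilySInv`,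
`kernelFamilyBInv`.
-/

noncomputable section

namespace Literature.MathematicalPhysics.QuantumFieldTheory.Balaban1983to89.B9CubeLettersInvReadings

open Node00
open B9Eq39Adjoint (R R_smul R_sub R_zero R_inv_R R_R_inv)
open B6KLevelCensusIndexV1 (KIdx Adm)
open B6GlobalChartV1 (PV blkV1)
open B6Geom246MultiLevelBox (blkOf)
open B6Ineq2142KLevelV1 (β)
open B6Prop22KLevelCensusEta (epow)
open B8ScaledSupNorm (msup)
open B9BackgroundsKLevelV1 (CfgV1 shiftsV1)
open scoped Matrix

variable {d ℓ : ℕ} {hd : 1 ≤ d + 1} {hL : Odd (ℓ + 1) ∧ 1 < ℓ + 1} {b₀ b₁ : ℝ}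
variable {𝔸 : Type} [NormedRing 𝔸] [NormedAlgebra ℂ 𝔸] [CompleteSpace 𝔸]

/-! ## §1 Bi-contractive gauge functions; the invariant test class and the action of `R(u)` on it -/

section TestClass

variable {X : Type}

/-- **a unit-valued lattice function is a BI-CONTRACTION**: `‖u(x)‖ ≤ 1` and `‖u(x)⁻¹‖ ≤ 1` at every point — the typed content of «u(x) ∈ G ⊂ U(N)»
that makes `R(u(x))` an isometry of the fibre. [cite: Balaban1985BackgroundPropagators, p.390 (|X| normalised H–S norm, G ⊂ U(N)), (3.28) p.395] -/
def IsBiContr (γ : X → 𝔸ˣ) : Prop := ∀ x, ‖(γ x : 𝔸)‖ ≤ 1 ∧ ‖(((γ x)⁻¹ : 𝔸ˣ) : 𝔸)‖ ≤ 1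

omit [NormedAlgebra ℂ 𝔸] [CompleteSpace 𝔸] in
/-- the inverse of a bi-contraction is one. [cite: Balaban1985BackgroundPropagators, (3.28) p.395, bookkeeping] -/
theorem IsBiContr.inv {γ : X → 𝔸ˣ} (h : IsBiContr γ) : IsBiContr γ⁻¹ := fun x =>
  ⟨by rw [Pi.inv_apply]; exact (h x).2, by rw [Pi.inv_apply, inv_inv]; exact (h x).1⟩

omit [NormedAlgebra ℂ 𝔸] [CompleteSpace 𝔸] in
/-- **`|R(u(x))Y| = |Y|`** for a bi-contraction. [cite: Balaban1985BackgroundPropagators, p.390, (3.28) p.395 (R(u) unitary on the fibre)] -/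
theorem IsBiContr.norm_R {γ : X → 𝔸ˣ} (h : IsBiContr γ) (x : X) (a : 𝔸) : ‖R (γ x) a‖ = ‖a‖ := by
  refine le_antisymm (B9Eq310Hermitian.norm_R_le (h x).1 (h x).2 a) ?_
  calc ‖a‖ = ‖R (γ x)⁻¹ (R (γ x) a)‖ := by rw [R_inv_R]
    _ ≤ ‖R (γ x) a‖ := B9Eq310Hermitian.norm_R_inv_le (h x).1 (h x).2 _

omit [NormedAlgebra ℂ 𝔸] [CompleteSpace 𝔸] in
/-- the trivial gauge function is a bi-contraction when `‖1‖ ≤ 1` (e.g. `M_N(ℂ)`). [cite: Balaban1985BackgroundPropagators, (3.28) p.395, bookkeeping] -/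
theorem IsBiContr.one (h1 : ‖(1 : 𝔸)‖ ≤ 1) : IsBiContr (fun _ : X => (1 : 𝔸ˣ)) := fun _ =>
  ⟨by rw [Units.val_one]; exact h1, by rw [inv_one, Units.val_one]; exact h1⟩

variable (𝔸) in
/-- **THE GAUGE-INVARIANT TEST CLASS of a scalar profile `f`**: the `𝔸`-valued lattice functions `Λ` with `‖Λ(z)‖ ≤ |f(z)|` at every point (so
`supp Λ ⊂ supp f` and `|Λ| ≤ |f|`; contains every product `f ⊗ E`, `‖E‖ ≤ 1`). [cite: Balaban1985BackgroundPropagators, (3.39) p.397 (sups over all 𝔤-valued λ)] -/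
def TestY (f : X → ℝ) : Type := {Λ : X → 𝔸 // ∀ z, ‖Λ z‖ ≤ |f z|}

omit [NormedAlgebra ℂ 𝔸] [CompleteSpace 𝔸] in
/-- the class is inhabited (by `0`). [cite: Balaban1985BackgroundPropagators, (3.39) p.397, bookkeeping] -/
theorem testY_nonempty (f : X → ℝ) : Nonempty (TestY 𝔸 f) := ⟨⟨0, fun z => by rw [Pi.zero_apply, norm_zero]; exact abs_nonneg _⟩⟩

/-- the products `f ⊗ E`, `E` in the unit ball, lie in the class (`norm_liftY_le`). [cite: Balaban1985BackgroundPropagators, (3.39) p.397, bookkeeping] -/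
def testYOfBall (f : X → ℝ) (E : BallY 𝔸) : TestY 𝔸 f := ⟨liftY f (E : 𝔸), norm_liftY_le f E⟩

/-- the product member, as a function. [cite: Balaban1985BackgroundPropagators, (3.39) p.397, bookkeeping] -/
@[simp] theorem testYOfBall_coe (f : X → ℝ) (E : BallY 𝔸) : (testYOfBall f E : TestY 𝔸 f).1 = liftY f (E : 𝔸) := rfl

/-- **`R(u)` ACTS ON THE TEST CLASS** (a bijection, inverse `R(u⁻¹)`) when `u` is a bi-contraction: `‖R(u(z))Λ(z)‖ = ‖Λ(z)‖ ≤ |f(z)|`.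
[cite: Balaban1985BackgroundPropagators, (3.28) p.395, (3.39) p.397] -/
def testYConj {γ : X → 𝔸ˣ} (h : IsBiContr γ) (f : X → ℝ) : TestY 𝔸 f ≃ TestY 𝔸 f where
  toFun Λ := ⟨conjY γ Λ.1, fun z => by rw [conjY_apply, h.norm_R]; exact Λ.2 z⟩
  invFun Λ := ⟨conjY γ⁻¹ Λ.1, fun z => by rw [conjY_apply, h.inv.norm_R]; exact Λ.2 z⟩
  left_inv Λ := Subtype.ext (funext fun z => by simp only [conjY_apply, Pi.inv_apply, R_inv_R])
  right_inv Λ := Subtype.ext (funext fun z => by simp only [conjY_apply, Pi.inv_apply, R_R_inv])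

omit [CompleteSpace 𝔸] in
/-- the action, as a function. [cite: Balaban1985BackgroundPropagators, (3.28) p.395, bookkeeping] -/
@[simp] theorem testYConj_coe {γ : X → 𝔸ˣ} (h : IsBiContr γ) (f : X → ℝ) (Λ : TestY 𝔸 f) : (testYConj h f Λ).1 = conjY γ Λ.1 := rfl

/-- `R(w)` is a bijection of the unit ball of `𝔸` for a bi-contractive unit `w` (the directions `E` of the (3.48) kernel reading).
[cite: Balaban1985BackgroundPropagators, (3.48) p.398, (3.33) p.396] -/
def ballConj {γ : X → 𝔸ˣ} (h : IsBiContr γ) (x : X) : BallY 𝔸 ≃ BallY 𝔸 where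
  toFun E := ⟨R (γ x) (E : 𝔸), mem_closedBall_zero_iff.2 (by rw [h.norm_R]; exact mem_closedBall_zero_iff.1 E.2)⟩
  invFun E := ⟨R (γ x)⁻¹ (E : 𝔸), mem_closedBall_zero_iff.2 (by
    rw [show (γ x)⁻¹ = γ⁻¹ x from rfl, h.inv.norm_R]; exact mem_closedBall_zero_iff.1 E.2)⟩
  left_inv E := Subtype.ext (by simp only [R_inv_R])
  right_inv E := Subtype.ext (by simp only [R_R_inv])

/-- the ball action, as an element. [cite: Balaban1985BackgroundPropagators, (3.48) p.398, bookkeeping] -/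
@[simp] theorem ballConj_coe {γ : X → 𝔸ˣ} (h : IsBiContr γ) (x : X) (E : BallY 𝔸) : ((ballConj h x E : BallY 𝔸) : 𝔸) = R (γ x) (E : 𝔸) := rfl

omit [CompleteSpace 𝔸] in
/-- `R(u)(δ_w ⊗ E) = δ_w ⊗ R(u(w))E`. [cite: Balaban1985BackgroundPropagators, (3.48) p.398, (3.28) p.395] -/
theorem deltaY_conj (γ : X → 𝔸ˣ) (w : X) (E : 𝔸) : conjY γ (deltaY w E) = deltaY w (R (γ w) E) := by
  funext z
  rw [conjY_apply]
  unfold deltaY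
  by_cases hz : z = w
  · rw [if_pos hz, if_pos hz, hz]
  · rw [if_neg hz, if_neg hz, R_zero]

omit [NormedAlgebra ℂ 𝔸] [CompleteSpace 𝔸] in
/-- the flat weighted `L²` quantity sees only `‖Ψ(z)‖`: invariant under a bi-contractive `R(u)`. [cite: Balaban1985BackgroundPropagators, (3.46) p.398 + p.398 (gauge invariance)] -/
theorem l2OfY_congrR [Fintype X] {γ : X → 𝔸ˣ} (h : IsBiContr γ) (hh : X → ℝ) {Ψ Ψ' : X → 𝔸} (hΨ : ∀ z, Ψ' z = R (γ z) (Ψ z)) :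
    l2OfY hh Ψ' = l2OfY hh Ψ := by
  simp only [l2OfY, hΨ, h.norm_R]

end TestClass

/-! ## §2 The readings of (3.42)–(3.47) see `Ψ` through `‖Ψ(z)‖` and covariant Hölder differences: invariance under `R(u)` -/

section Readings

variable (i : KIdx d ℓ hd hL b₀ b₁)

omit [NormedAlgebra ℂ 𝔸] [CompleteSpace 𝔸] in
/-- `sup_{z ∈ Δ(s)} ‖R(u(z))Ψ(z)‖ = sup_{z ∈ Δ(s)} ‖Ψ(z)‖`. [cite: Balaban1985BackgroundPropagators, (3.42) p.397 + p.398 (gauge invariance)] -/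
theorem supBlkS_congrR {γ : SiteY i → 𝔸ˣ} (h : IsBiContr γ) (s : BlkY i) {Ψ Ψ' : SiteY i → 𝔸} (hΨ : ∀ z, Ψ' z = R (γ z) (Ψ z)) :
    supBlkS i s Ψ' = supBlkS i s Ψ := by
  simp only [supBlkS, hΨ, h.norm_R]

omit [NormedAlgebra ℂ 𝔸] [CompleteSpace 𝔸] in
/-- the same for the direction-indexed block sup. [cite: Balaban1985BackgroundPropagators, (3.42) p.397 + p.398 (gauge invariance)] -/
theorem supBlkS'_congrR {γ : SiteY i → 𝔸ˣ} (h : IsBiContr γ) (s : BlkY i) {Ψ Ψ' : Fin (d + 1) → SiteY i → 𝔸}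
    (hΨ : ∀ μ z, Ψ' μ z = R (γ z) (Ψ μ z)) : supBlkS' i s Ψ' = supBlkS' i s Ψ := by
  simp only [supBlkS', hΨ, h.norm_R]

omit [NormedAlgebra ℂ 𝔸] [CompleteSpace 𝔸] in
/-- the same for the bond-sector block sup. [cite: Balaban1985BackgroundPropagators, (3.42) p.397 + p.398 (gauge invariance)] -/
theorem supInB_congrR {γ : FBondY i → 𝔸ˣ} (h : IsBiContr γ) (y : BlkY i) {Ψ Ψ' : FBondY i → 𝔸} (hΨ : ∀ x, Ψ' x = R (γ x) (Ψ x)) :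
    supInB i y Ψ' = supInB i y Ψ := by
  simp only [supInB, hΨ, h.norm_R]

omit [NormedAlgebra ℂ 𝔸] [CompleteSpace 𝔸] in
/-- `|R(u)Ψ|_{(α)} = |Ψ|_{(α)}` on the site sector. [cite: Balaban1985BackgroundPropagators, (3.41) p.397 + p.398 (gauge invariance)] -/
theorem wNormSY_congrR {γ : SiteY i → 𝔸ˣ} (h : IsBiContr γ) (α : ℝ) {Ψ Ψ' : SiteY i → 𝔸} (hΨ : ∀ z, Ψ' z = R (γ z) (Ψ z)) :
    wNormSY i α Ψ' = wNormSY i α Ψ := by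
  simp only [wNormSY, msup, hΨ, h.norm_R]

omit [NormedAlgebra ℂ 𝔸] [CompleteSpace 𝔸] in
/-- `|R(u)Ψ|_{(α)} = |Ψ|_{(α)}` on the bond sector. [cite: Balaban1985BackgroundPropagators, (3.41) p.397 + p.398 (gauge invariance)] -/
theorem wNormBY_congrR {γ : FBondY i → 𝔸ˣ} (h : IsBiContr γ) (α : ℝ) {Ψ Ψ' : FBondY i → 𝔸} (hΨ : ∀ x, Ψ' x = R (γ x) (Ψ x)) :
    wNormBY i α Ψ' = wNormBY i α Ψ := by
  simp only [wNormBY, msup, hΨ, h.norm_R]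

omit [NormedAlgebra ℂ 𝔸] [CompleteSpace 𝔸] in
/-- **THE COVARIANT HÖLDER QUOTIENT (3.40) IS GAUGE INVARIANT** (site sector): the transporter transforms as a contour variable
`U^u(Γ_{z,z′}) = u(z)U(Γ_{z,z′})u(z′)⁻¹`, so `R(U^u(Γ))R(u(z′))Ψ(z′) − R(u(z))Ψ(z) = R(u(z))(R(U(Γ))Ψ(z′) − Ψ(z))`.
[cite: Balaban1985BackgroundPropagators, (3.40) p.397, (3.32) p.395 + p.398 (gauge invariance)] -/
theorem hqS_congrR {γ : SiteY i → 𝔸ˣ} (h : IsBiContr γ) {par par' : SiteY i → SiteY i → 𝔸ˣ} (hpar : ∀ z z', par' z z' = γ z * par z z' * (γ z')⁻¹)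
    (α : ℝ) {Ψ Ψ' : SiteY i → 𝔸} (hΨ : ∀ z, Ψ' z = R (γ z) (Ψ z)) : hqS i par' α Ψ' = hqS i par α Ψ := by
  unfold hqS
  congr 1
  funext p
  split_ifs
  · rw [hΨ, hΨ, hpar, B9Eq39Adjoint.R_mul, B9Eq39Adjoint.R_mul, R_inv_R, ← R_sub, h.norm_R]
  · rfl

omit [CompleteSpace 𝔸] in
/-- **THE COVARIANT HÖLDER QUOTIENT (3.40) IS GAUGE INVARIANT** (bond sector, r03's admissible pairs, weights `ζ`).
[cite: Balaban1985BackgroundPropagators, (3.40) p.397, (3.32) p.395 + p.398 (gauge invariance)] -/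
theorem holderQB_congrR {g : Site (PV d ℓ i.m i.K hd hL) 0 → 𝔸ˣ} (h : IsBiContr g)
    {par par' : Site (PV d ℓ i.m i.K hd hL) 0 → Site (PV d ℓ i.m i.K hd hL) 0 → 𝔸ˣ} (hpar : ∀ y x, par' y x = g y * par y x * (g x)⁻¹)
    (α : ℝ) (ζ : FBondY i → ℝ) {Ψ Ψ' : FBondY i → 𝔸} (hΨ : ∀ x, Ψ' x = R (g x.src) (Ψ x)) :
    holderQB i par' α ζ Ψ' = holderQB i par α ζ Ψ := by
  unfold holderQB
  congr 1
  funext q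
  split_ifs
  · have e : (((ζ q.1 : ℝ) : ℂ) • Ψ' q.1 - R (par' q.1.src q.2.src) (((ζ q.2 : ℝ) : ℂ) • Ψ' q.2))
        = R (g q.1.src) ((((ζ q.1 : ℝ) : ℂ) • Ψ q.1 - R (par q.1.src q.2.src) (((ζ q.2 : ℝ) : ℂ) • Ψ q.2))) := by
      simp only [hΨ, hpar, R_sub, R_smul, B9Eq39Adjoint.R_mul, R_inv_R]
    rw [e, h.norm_R]
  · rfl

/-! ### the gauge function read on the carriers; the invariances in rewriting form -/

/-- a bi-contractive `u` is bi-contractive read on the site carrier (box chart). [cite: Balaban1985BackgroundPropagators, (3.28) p.395, bookkeeping] -/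
theorem IsBiContr.site {g : GaugeY 𝔸 i} (h : IsBiContr g) : IsBiContr (gSiteY i g) := fun _ => h _

/-- … on the bond carrier (initial points). [cite: Balaban1985BackgroundPropagators, (3.28) p.395, bookkeeping] -/
theorem IsBiContr.bond {g : GaugeY 𝔸 i} (h : IsBiContr g) : IsBiContr (gBondY i g) := fun b => h b.src

/-- … on the block carrier (block corners). [cite: Balaban1985BackgroundPropagators, (3.28) p.395, bookkeeping] -/
theorem IsBiContr.blk {g : GaugeY 𝔸 i} (h : IsBiContr g) : IsBiContr (gBlkY i g) := fun _ => h _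

omit [CompleteSpace 𝔸] in
/-- `sup_{Δ(s)} ‖R(u)Ψ‖ = sup_{Δ(s)} ‖Ψ‖`, rewriting form. [cite: Balaban1985BackgroundPropagators, (3.42) p.397 + p.398 (gauge invariance)] -/
theorem supBlkS_conjY {γ : SiteY i → 𝔸ˣ} (h : IsBiContr γ) (s : BlkY i) (Ψ : SiteY i → 𝔸) : supBlkS i s (conjY γ Ψ) = supBlkS i s Ψ :=
  supBlkS_congrR i h s fun _ => rfl

omit [CompleteSpace 𝔸] in
/-- the direction-indexed form. [cite: Balaban1985BackgroundPropagators, (3.42) p.397 + p.398 (gauge invariance)] -/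
theorem supBlkS'_conjY {γ : SiteY i → 𝔸ˣ} (h : IsBiContr γ) (s : BlkY i) (Ψ : Fin (d + 1) → SiteY i → 𝔸) :
    supBlkS' i s (fun μ => conjY γ (Ψ μ)) = supBlkS' i s Ψ :=
  supBlkS'_congrR i h s fun _ _ => rfl

omit [CompleteSpace 𝔸] in
/-- the bond-sector block sup, rewriting form. [cite: Balaban1985BackgroundPropagators, (3.42) p.397 + p.398 (gauge invariance)] -/
theorem supInB_conjY {γ : FBondY i → 𝔸ˣ} (h : IsBiContr γ) (y : BlkY i) (Ψ : FBondY i → 𝔸) : supInB i y (conjY γ Ψ) = supInB i y Ψ :=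
  supInB_congrR i h y fun _ => rfl

omit [CompleteSpace 𝔸] in
/-- the flat `L²` quantity, rewriting form. [cite: Balaban1985BackgroundPropagators, (3.46) p.398 + p.398 (gauge invariance)] -/
theorem l2OfY_conjY {X : Type} [Fintype X] {γ : X → 𝔸ˣ} (h : IsBiContr γ) (hh : X → ℝ) (Ψ : X → 𝔸) : l2OfY hh (conjY γ Ψ) = l2OfY hh Ψ :=
  l2OfY_congrR h hh fun _ => rfl

omit [CompleteSpace 𝔸] in
/-- `|R(u)Ψ|_{(α)} = |Ψ|_{(α)}` (site sector), rewriting form. [cite: Balaban1985BackgroundPropagators, (3.41) p.397 + p.398 (gauge invariance)] -/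
theorem wNormSY_conjY {γ : SiteY i → 𝔸ˣ} (h : IsBiContr γ) (α : ℝ) (Ψ : SiteY i → 𝔸) : wNormSY i α (conjY γ Ψ) = wNormSY i α Ψ :=
  wNormSY_congrR i h α fun _ => rfl

omit [CompleteSpace 𝔸] in
/-- `|c·R(u)Ψ|_{(α)} = |c·Ψ|_{(α)}` for a real weight `c` (the `η`-prefactors of (3.47)). [cite: Balaban1985BackgroundPropagators, (3.47) p.398 + p.398 (gauge invariance)] -/
theorem wNormSY_smul_conjY {γ : SiteY i → 𝔸ˣ} (h : IsBiContr γ) (α : ℝ) (c : SiteY i → ℝ) (Ψ : SiteY i → 𝔸) :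
    wNormSY i α (fun z => ((c z : ℝ) : ℂ) • conjY γ Ψ z) = wNormSY i α (fun z => ((c z : ℝ) : ℂ) • Ψ z) :=
  wNormSY_congrR i h α fun z => by simp only [conjY_apply, R_smul]

omit [CompleteSpace 𝔸] in
/-- `|R(u)Ψ|_{(α)} = |Ψ|_{(α)}` (bond sector), rewriting form. [cite: Balaban1985BackgroundPropagators, (3.41) p.397 + p.398 (gauge invariance)] -/
theorem wNormBY_conjY {γ : FBondY i → 𝔸ˣ} (h : IsBiContr γ) (α : ℝ) (Ψ : FBondY i → 𝔸) : wNormBY i α (conjY γ Ψ) = wNormBY i α Ψ :=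
  wNormBY_congrR i h α fun _ => rfl

/-- **the weighted covariant Hölder quotient of the site sector at `U^u` on `R(u)Ψ` equals the one at `U` on `Ψ`** (lawful transporter).
[cite: Balaban1985BackgroundPropagators, (3.40) p.397, (3.43)∕(3.45) p.398 + p.398 (gauge invariance)] -/
theorem hqS_smul_conjY {par : SiteParY 𝔸 i} (hpar : IsGaugeLawS i par) {g : GaugeY 𝔸 i} (hg : IsBiContr g) (V : CfgY 𝔸 i) (α : ℝ)
    (c : SiteY i → ℝ) (Ψ : SiteY i → 𝔸) :
    hqS i (par (gaugeY i g V)) α (fun w => ((c w : ℝ) : ℂ) • conjY (gSiteY i g) Ψ w) = hqS i (par V) α (fun w => ((c w : ℝ) : ℂ) • Ψ w) :=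
  hqS_congrR i (hg.site i) (fun z z' => hpar g V z z') α fun w => by simp only [conjY_apply, R_smul]

/-- **the bond-sector covariant Hölder quotient at `U^u` on `R(u)Ψ` equals the one at `U` on `Ψ`** (lawful transporter).
[cite: Balaban1985BackgroundPropagators, (3.40) p.397, (3.43)∕(3.45) p.398 + p.398 (gauge invariance)] -/
theorem holderQB_conjY {par : BondParY 𝔸 i} (hpar : IsGaugeLawB i par) {g : GaugeY 𝔸 i} (hg : IsBiContr g) (V : CfgY 𝔸 i) (α : ℝ)
    (ζ : FBondY i → ℝ) (Ψ : FBondY i → 𝔸) :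
    holderQB i (par (gaugeY i g V)) α ζ (conjY (gBondY i g) Ψ) = holderQB i (par V) α ζ Ψ :=
  holderQB_congrR i hg (fun y x => hpar g V y x) α ζ fun _ => rfl

/-! ### the calculus laws (3.31)′ as function identities, site and bond sectors -/

/-- `∇_{U^u,μ}R(u) = R(u)∇_{U,μ}` (site sector), as functions. [cite: Balaban1985BackgroundPropagators, (3.3) p.390, (3.31) p.395] -/
theorem cdS_conj (g : GaugeY 𝔸 i) (V : CfgY 𝔸 i) (μ : Fin (d + 1)) (Φ : SiteY i → 𝔸) :
    cdS i (gaugeY i g V) μ (conjY (gSiteY i g) Φ) = conjY (gSiteY i g) (cdS i V μ Φ) :=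
  funext fun z => cdS_gaugeY i g V μ Φ z

/-- `∇*_{U^u,μ}R(u) = R(u)∇*_{U,μ}` (site sector), as functions. [cite: Balaban1985BackgroundPropagators, (3.8) p.392, (3.31) p.395] -/
theorem cdsS_conj (g : GaugeY 𝔸 i) (V : CfgY 𝔸 i) (μ : Fin (d + 1)) (Φ : SiteY i → 𝔸) :
    cdsS i (gaugeY i g V) μ (conjY (gSiteY i g) Φ) = conjY (gSiteY i g) (cdsS i V μ Φ) :=
  funext fun z => cdsS_gaugeY i g V μ Φ z

/-- `Δ_{U^u}R(u) = R(u)Δ_U` (3.31), as functions. [cite: Balaban1985BackgroundPropagators, (3.23) p.394, (3.31) p.395] -/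
theorem lapS_conj (g : GaugeY 𝔸 i) (V : CfgY 𝔸 i) (Φ : SiteY i → 𝔸) :
    lapS i (gaugeY i g V) (conjY (gSiteY i g) Φ) = conjY (gSiteY i g) (lapS i V Φ) :=
  (lapSL_cov i g V).apply Φ

/-- NODE 00's `U^u` is `B9Eq3117Current.gaugeTr` for the torus shifts. [cite: Balaban1985BackgroundPropagators, (3.28) p.395, dictionary] -/
theorem gaugeY_eq_gaugeTr (g : GaugeY 𝔸 i) (V : CfgY 𝔸 i) : gaugeY i g V = B9Eq3117Current.gaugeTr (shiftsV1 _) g V := by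
  funext μ x; rw [gaugeY_apply, B9Eq3117Current.gaugeTr_apply]; rfl

/-- `∇_{U^u,μ}R(u) = R(u)∇_{U,μ}` (bond sector, physical units), as functions. [cite: Balaban1985BackgroundPropagators, (3.3) p.390, (3.31) p.395] -/
theorem cdB_conj (g : GaugeY 𝔸 i) (V : CfgY 𝔸 i) (μ : Fin (d + 1)) (A : FBondY i → 𝔸) :
    cdB i (gaugeY i g V) μ (conjY (gBondY i g) A) = conjY (gBondY i g) (cdB i V μ A) := by
  funext b
  simp only [cdB, conjY_apply, gBondY]
  rw [gaugeY_eq_gaugeTr, R_smul]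
  exact congrArg _ (B9Eq3117Current.covD_gaugeTr _ V g μ (fun s => A ⟨s, b.dir⟩) b.src)

/-- `∇*_{U^u,μ}R(u) = R(u)∇*_{U,μ}` (bond sector), as functions. [cite: Balaban1985BackgroundPropagators, (3.8) p.392, (3.31) p.395] -/
theorem cdsB_conj (g : GaugeY 𝔸 i) (V : CfgY 𝔸 i) (μ : Fin (d + 1)) (A : FBondY i → 𝔸) :
    cdsB i (gaugeY i g V) μ (conjY (gBondY i g) A) = conjY (gBondY i g) (cdsB i V μ A) := by
  funext b
  simp only [cdsB, conjY_apply, gBondY]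
  rw [gaugeY_eq_gaugeTr, R_smul]
  exact congrArg _ (B9Eq3117Current.covDstar_gaugeTr _ V g μ (fun s => A ⟨s, b.dir⟩) b.src)

/-- `Δ_{U^u}R(u) = R(u)Δ_U` (bond sector), as functions. [cite: Balaban1985BackgroundPropagators, (3.23) p.394, (3.31) p.395] -/
theorem lapB_conj (g : GaugeY 𝔸 i) (V : CfgY 𝔸 i) (A : FBondY i → 𝔸) :
    lapB i (gaugeY i g V) (conjY (gBondY i g) A) = conjY (gBondY i g) (lapB i V A) := by
  funext b
  have h : ∀ μ, cdB i (gaugeY i g V) μ (conjY (gBondY i g) A) = conjY (gBondY i g) (cdB i V μ A) := fun μ => cdB_conj i g V μ A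
  simp only [lapB, h, cdsB_conj, conjY_apply]
  exact (map_sum (RL (gBondY i g b)) _ _).symm

end Readings

/-! ## §3 The readings of a letter over the invariant class: def-Y's functors with the outer sup over `TestY 𝔸 f` -/

section Families

variable (i : KIdx d ℓ hd hL b₀ b₁)

open Classical in
/-- **THE `B9.KernelFamily` READING OF A SITE-SECTOR LETTER OVER THE INVARIANT CLASS** — `Node00.kernelFamilyS` verbatim (entries (3.42) via
`eLatS`, (3.43) via `hLatS`, (3.44)–(3.47)) with the outer `⨆ E : BallY 𝔸, …(λ ⊗ E)` replaced by `⨆ Λ : TestY 𝔸 λ, …Λ` (print's sup over all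
M_N-valued test functions dominated by the profile `λ`). [cite: Balaban1985BackgroundPropagators, Thm 3.1 (3.42)–(3.47) pp.397–398, (3.39) p.397] -/
def kernelFamilySInv (B : B9.Backgrounds) (cfg : B.Cfg → CfgY 𝔸 i) (O : SiteOpY 𝔸 i) (par : SiteParY 𝔸 i) :
    B9.KernelFamily (B9GeoNormsKLevelV1.geo9K i) B where
  e := fun n U' lam b => let U := cfg U'; match lam with
    | .inl f => etaS i ^ (epow n) * ⨆ Λ : TestY 𝔸 f, eLatS i O U Λ.1 (β i.hN i.D i.hk b) n
    | .inr _ => 0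
  h1 := fun U' lam α ζ => let U := cfg U'; match lam, ζ with
    | .inl f, .inl z => ⨆ Λ : TestY 𝔸 f, hLatS i O par U Λ.1 α z
    | _, _ => 0
  e4 := fun U' lam b => let U := cfg U'; match lam with
    | .inl f => ⨆ Λ : TestY 𝔸 f, ⨆ μ : Fin (d + 1),
        supBlkS' i (β i.hN i.D i.hk b) (fun ν => cdS i U μ (O U (cdsS i U ν Λ.1)))
    | .inr _ => 0
  h2 := fun U' lam α ζ => let U := cfg U'; match lam, ζ with
    | .inl f, .inl z => ⨆ Λ : TestY 𝔸 f, ⨆ μ : Fin (d + 1), ⨆ ν : Fin (d + 1),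
        hqS i (par U) α (fun w => ((z w : ℝ) : ℂ) • cdS i U μ (O U (cdsS i U ν Λ.1)) w)
    | _, _ => 0
  l2 := fun n U' lam h => let U := cfg U'; match lam, h with
    | .inl f, .inl hh => etaS i ^ ((![2, 1, 1, 0, 0, 0] : Fin 6 → ℕ) n) * ⨆ Λ : TestY 𝔸 f,
        ((![l2OfY hh (O U Λ.1),
            ⨆ μ : Fin (d + 1), l2OfY hh (cdS i U μ (O U Λ.1)),
            ⨆ μ : Fin (d + 1), l2OfY hh (O U (cdsS i U μ Λ.1)),
            ⨆ μ : Fin (d + 1), ⨆ ν : Fin (d + 1), l2OfY hh (cdS i U μ (O U (cdsS i U ν Λ.1))),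
            ⨆ μ : Fin (d + 1), ⨆ ν : Fin (d + 1), l2OfY hh (cdS i U μ (cdS i U ν (O U Λ.1))),
            ⨆ μ : Fin (d + 1), ⨆ ν : Fin (d + 1), l2OfY hh (O U (cdsS i U μ (cdsS i U ν Λ.1)))] : Fin 6 → ℝ) n)
    | _, _ => 0
  glob := fun n U' lam γ => let U := cfg U'; match lam with
    | .inl f => ⨆ Λ : TestY 𝔸 f,
        ((![wNormSY i (2 + γ) (fun z => ((etaS i ^ 2 : ℝ) : ℂ) • O U Λ.1 z),
            ⨆ μ : Fin (d + 1), wNormSY i (1 + γ) (fun z => ((etaS i : ℝ) : ℂ) • cdS i U μ (O U Λ.1) z),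
            ⨆ μ : Fin (d + 1), wNormSY i (1 + γ) (fun z => ((etaS i : ℝ) : ℂ) • O U (cdsS i U μ Λ.1) z),
            wNormSY i γ (lapS i U (O U Λ.1))] : Fin 4 → ℝ) n)
    | .inr _ => 0

open Classical in
/-- **THE `B9.KernelFamily` READING OF A BOND-SECTOR LETTER OVER THE INVARIANT CLASS** — `Node00.kernelFamilyB` verbatim with the outer
`⨆ E : BallY 𝔸, …(J ⊗ E)` replaced by `⨆ Λ : TestY 𝔸 J, …Λ`. [cite: Balaban1985BackgroundPropagators, Thm 3.3 p.399 + (3.42)–(3.47) pp.397–398, (3.39) p.397] -/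
def kernelFamilyBInv (B : B9.Backgrounds) (cfg : B.Cfg → CfgY 𝔸 i) (O : BondOpY 𝔸 i) (par : BondParY 𝔸 i) :
    B9.KernelFamily (B9GeoNormsKLevelV1.geo9K i) B where
  e := fun n U' lam b => let U := cfg U'; match lam with
    | .inr J => ⨆ Λ : TestY 𝔸 J,
        ((![supInB i (β i.hN i.D i.hk b) (O U Λ.1),
            ⨆ ν : Fin (d + 1), supInB i (β i.hN i.D i.hk b) (cdB i U ν (O U Λ.1)),
            ⨆ ν : Fin (d + 1), supInB i (β i.hN i.D i.hk b) (O U (cdsB i U ν Λ.1)),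
            supInB i (β i.hN i.D i.hk b) (lapB i U (O U Λ.1))] : Fin 4 → ℝ) n)
    | .inl _ => 0
  h1 := fun U' lam α ζ => let U := cfg U'; match lam, ζ with
    | .inr J, .inr z => ⨆ Λ : TestY 𝔸 J,
        max (⨆ ν : Fin (d + 1), holderQB i (par U) α z (cdB i U ν (O U Λ.1)))
          (⨆ ν : Fin (d + 1), holderQB i (par U) α z (O U (cdsB i U ν Λ.1)))
    | _, _ => 0
  e4 := fun U' lam b => let U := cfg U'; match lam with
    | .inr J => ⨆ Λ : TestY 𝔸 J, ⨆ ν : Fin (d + 1), ⨆ μ : Fin (d + 1),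
        supInB i (β i.hN i.D i.hk b) (cdB i U ν (O U (cdsB i U μ Λ.1)))
    | .inl _ => 0
  h2 := fun U' lam α ζ => let U := cfg U'; match lam, ζ with
    | .inr J, .inr z => ⨆ Λ : TestY 𝔸 J, ⨆ ν : Fin (d + 1), ⨆ μ : Fin (d + 1),
        holderQB i (par U) α z (cdB i U ν (O U (cdsB i U μ Λ.1)))
    | _, _ => 0
  l2 := fun n U' lam h => let U := cfg U'; match lam, h with
    | .inr J, .inr hh => ⨆ Λ : TestY 𝔸 J,
        ((![l2OfY hh (O U Λ.1),
            ⨆ ν : Fin (d + 1), l2OfY hh (cdB i U ν (O U Λ.1)),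
            ⨆ ν : Fin (d + 1), l2OfY hh (O U (cdsB i U ν Λ.1)),
            ⨆ ν : Fin (d + 1), ⨆ μ : Fin (d + 1), l2OfY hh (cdB i U ν (O U (cdsB i U μ Λ.1))),
            ⨆ ν : Fin (d + 1), ⨆ μ : Fin (d + 1), l2OfY hh (cdB i U ν (cdB i U μ (O U Λ.1))),
            ⨆ ν : Fin (d + 1), ⨆ μ : Fin (d + 1), l2OfY hh (O U (cdsB i U ν (cdsB i U μ Λ.1)))] : Fin 6 → ℝ) n)
    | _, _ => 0
  glob := fun n U' lam γ => let U := cfg U'; match lam with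
    | .inr J => ⨆ Λ : TestY 𝔸 J,
        ((![wNormBY i (2 + γ) (O U Λ.1),
            ⨆ ν : Fin (d + 1), wNormBY i (1 + γ) (cdB i U ν (O U Λ.1)),
            ⨆ ν : Fin (d + 1), wNormBY i (1 + γ) (O U (cdsB i U ν Λ.1)),
            wNormBY i γ (lapB i U (O U Λ.1))] : Fin 4 → ℝ) n)
    | .inl _ => 0

end Families

end Literature.MathematicalPhysics.QuantumFieldTheory.Balaban1983to89.B9CubeLettersInvReadings

end
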